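import Summits.ABC.ABC.Theses.IneffectiveSubspace

/-!
# Line `Sketch` (card `omega-collapse`) for the crux `DeepRegimeABC` (stmt-ABC-15121) — registered skeleton

The planners' sketch `Cruxes/DeepRegimeABC/SketchIdeator2.lean` is sorry-free but concludes the crux only
through `deepRegime_of_manyPrimes : ManyPrimesABC → DeepRegimeABC`, and proves in the same file
`deepRegime_iff_manyPrimes : DeepRegimeABC ↔ ManyPrimesABC`.  As a LINE it therefore has exactly one
stub — abc on the `ε`-dependent many-primes tail `{ω(abc) ≥ W(ε)}` — and that stub is the crux itself in
`ω`-normal form.  This file is that honest registered shape (def-free):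

* `stub_omegaTailABC` — the stub (≡ the crux, by `deepRegime_iff_manyPrimes`; the non-trivial direction
  is landed sorry-free as `Summit.ABC.ABC.Theorems.DeepRegimeABC.omegaTail_of_deepRegimeABC` in
  `Theorems/IneffectiveSubspaceDeepRegimeABCOmegaTail.lean`);
* `DeepRegimeABC_of` — the composition, i.e. the trivial direction `ω₅(abc) ≤ ω(abc)`.
-/

-- `Summit.ABC.ABC…` is the mandated summit-side namespace (CONVENTIONS §2); the duplicate is deliberate.
set_option linter.dupNamespace false

namespace Summit.ABC.ABC.Cruxes.DeepRegimeABC.Sketch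

open Literature.NumberTheory.DiophantineGeometry
open Summit.ABC.ABC.Theses.IneffectiveSubspace

/-- **STUB** (the whole crux in `ω`-normal form): abc on the `ε`-dependent many-primes tail — for every
`ε > 0` there are `W` and `C > 0` such that every abc triple with `ω(abc) ≥ W` has `c < C·rad(abc)^(1+ε)`. -/
theorem stub_omegaTailABC :
    ∀ ε : ℝ, 0 < ε → ∃ W : ℕ, ∃ C : ℝ, 0 < C ∧ ∀ a b c : ℕ, IsABCTriple a b c →
      W ≤ (a * b * c).primeFactors.card → (c : ℝ) < C * ((rad a b c : ℕ) : ℝ) ^ (1 + ε) := by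
  sorry

/-- **Composition**: the deep tail `{ω₅(abc) ≥ K}` lies inside the many-primes tail `{ω(abc) ≥ K}`
(`ω₅ ≤ ω`, `Finset.card_filter_le`), so the stub gives the crux with `K := W`, same constant. -/
theorem DeepRegimeABC_of : DeepRegimeABC := by
  intro ε hε
  obtain ⟨W, C, hC, hW⟩ := stub_omegaTailABC ε hε
  exact ⟨W, C, hC, fun a b c habc hK => hW a b c habc (hK.trans (Finset.card_filter_le _ _))⟩

end Summit.ABC.ABC.Cruxes.DeepRegimeABC.Sketch
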